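import Literature.Analysis.PDE.FlatStep
import HarnessLib

/-!
# One step of the flat fine parametrix: the contraction estimate (topic `Analysis/PDE`)

Continuation of `FlatStep.lean` (layer (I') of the programme to prove short-time existence for
quasilinear strictly parabolic systems on a closed manifold, hypothesis `hQL` of
`Literature.Geometry.Riemannian.ricciFlow_shortTime_existence_of_quasilinear`). In the per-patch
adapted data norm

  `𝒩_k(Θ)(t) = Σ_i ∫₀ᵗ e^{-2λs} E_k(Θ̃_i(s)) ds`,  `Θ̃_i = dataAd Q A Θ i`,

the assembled residual `errOne` of one step is bounded by the data:

  `𝒩_k(errOne)(t) ≤ m'² Ctr [2 K₁(λ) + C_sh Mρ² K₂(λ)] 𝒩_k(Θ)(t)`   (`lintegral_weight_sum_dataAd_errOne_le`),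

where `m'` bounds the number of neighbours of a patch, `Ctr` the transport constants of the
affine transitions between neighbouring adapted coordinates, `K₁(λ) = A₀ n + B₀ (λ⁻¹/2 + λ⁻²)` and
`K₂(λ) = A₀ n λ⁻¹/2 + B₀ (λ⁻¹/2 + λ⁻²)` come from the per-patch slice bounds of the flat local
residual (`A₀ = 80 n² η²`) and the global heat engine, and `C_sh`, `Mρ` from the sharp product
rule with the partition functions. The proof: the re-localisation identity
(`dataAd_errOne_eq`: only neighbours contribute), `E(Σ) ≤ # · Σ E`, the sharp product rule,
the transport of energies under affine maps, the weighted bounds of `FlatLocalResidual.lean`, and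
neighbour double counting.

Everything is proved; no named fact and no `sorry` is introduced.

## References

* L. Hörmander, *The Analysis of Linear Partial Differential Operators III*, Springer 1985,
  §17.1. [Hormander1985III]
-/

noncomputable section

open Set Function Filter Topology Metric MeasureTheory InnerProductSpace
open scoped ContDiff Topology ENNReal RealInnerProductSpace Laplacian

namespace Literature.Analysis.PDE

open Literature.Analysis.FunctionSpaces Literature.Analysis.FluidPDE

variable {E' : Type*} [NormedAddCommGroup E'] [InnerProductSpace ℝ E'] [FiniteDimensional ℝ E']
variable {F' : Type*} [NormedAddCommGroup F'] [InnerProductSpace ℝ F']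

namespace FlatStep

variable {ι : Type*} [Fintype ι] (Q : FlatPatches E' ι) (A : ι → E' ≃L[ℝ] E') (T : ℝ)
  (S : ℝ → E' → (E' →L[ℝ] E')) (𝔟 : ℝ → E' → ((E' →L[ℝ] F') →L[ℝ] F')) (𝔠 : ℝ → E' → (F' →L[ℝ] F'))
  (Θ : ℝ → E' → F')

/-! ### Neighbours and transitions -/

/-- The neighbours of patch `j`: centres within `5r`. [folklore] -/
def nbrs (j : ι) : Finset ι := by
  classical exact Finset.univ.filter fun i ↦ dist (Q.c j) (Q.c i) ≤ 5 * Q.r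

omit [FiniteDimensional ℝ E'] in
/-- `mem_nbrs`: mem nbrs. [folklore] -/
theorem mem_nbrs {i j : ι} : i ∈ nbrs Q j ↔ dist (Q.c j) (Q.c i) ≤ 5 * Q.r := by
  classical
  simp [nbrs]

omit [FiniteDimensional ℝ E'] in
/-- `mem_nbrs_comm`: mem nbrs comm. [folklore] -/
theorem mem_nbrs_comm {i j : ι} : i ∈ nbrs Q j ↔ j ∈ nbrs Q i := by
  rw [mem_nbrs, mem_nbrs, dist_comm]

omit [FiniteDimensional ℝ E'] in
/-- **Bounded number of neighbours.** [folklore] -/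
theorem card_nbrs_le (j : ι) : ((nbrs Q j).card : ℝ) ≤ (2 * (5 * Q.r) / Q.mesh + 1) ^ Module.finrank ℝ E' :=
  Q.card_neighbours_le j (by linarith [Q.r_pos]) _ fun _ hi ↦ (mem_nbrs Q).1 hi

omit [FiniteDimensional ℝ E'] in
/-- **The transitions between adapted coordinates are affine**:
`Ψ_i⁻¹ (Ψ_j z) = (A_i A_j⁻¹) z + A_i (c_j - c_i)`. [folklore] -/
theorem psiInv_psi_eq (i j : ι) (z : E') :
    psiInv Q A i (psi Q A j z) = ((A i : E' →L[ℝ] E') ∘L ((A j).symm : E' →L[ℝ] E')) z + A i (Q.c j - Q.c i) := by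
  simp only [psiInv, psi, ContinuousLinearMap.comp_apply, ContinuousLinearEquiv.coe_coe]
  rw [← map_add]
  congr 1
  abel

omit [FiniteDimensional ℝ E'] [Fintype ι] in
/-- The linear parts of the transitions are invertible. [folklore] -/
theorem det_transition_ne_zero (i j : ι) :
    LinearMap.det (((A i : E' →L[ℝ] E') ∘L ((A j).symm : E' →L[ℝ] E') : E' →L[ℝ] E') : E' →ₗ[ℝ] E') ≠ 0 := by
  have h : ((A i : E' →L[ℝ] E') ∘L ((A j).symm : E' →L[ℝ] E') : E' →L[ℝ] E') =
      (((A j).symm.trans (A i) : E' ≃L[ℝ] E') : E' →L[ℝ] E') := by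
    ext z; simp
  rw [h]
  exact (LinearEquiv.isUnit_det' (((A j).symm.trans (A i)).toLinearEquiv)).ne_zero

/-! ### The re-localisation identity -/

variable [MeasurableSpace E'] [BorelSpace E'] [FiniteDimensional ℝ F']

/-- A non-neighbour's residual vanishes where `ρ_j` does not. [folklore] -/
theorem errPiece_eq_zero_of_not_mem_nbrs {i j : ι} (hij : i ∉ nbrs Q j) (s : ℝ) {y : E'} (hy : Q.ρ j y ≠ 0) :
    errPiece Q A T S 𝔟 𝔠 Θ i s y = 0 := by
  have hyj : y ∈ ball (Q.c j) (2 * Q.r) := Q.tsupport_ρ j (subset_tsupport _ hy)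
  have hz : psiInv Q A i y ∉ tsupport (cutAd Q A i) := by
    intro h
    have h' := tsupport_comp_subset_preimage (Q.cut i : E' → ℝ) (f := psi Q A i) (contDiff_psi i).continuous h
    rw [mem_preimage, psi_psiInv, (Q.cut i).tsupport_eq, Q.cut_rOut] at h'
    have hd : dist (Q.c j) (Q.c i) ≤ 5 * Q.r := by
      calc dist (Q.c j) (Q.c i) ≤ dist (Q.c j) y + dist y (Q.c i) := dist_triangle _ _ _
        _ ≤ 2 * Q.r + 3 * Q.r := add_le_add (by rw [dist_comm]; exact (mem_ball.1 hyj).le) (mem_closedBall.1 h')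
        _ = 5 * Q.r := by ring
    exact hij ((mem_nbrs Q).2 hd)
  exact flatErr_eq_zero_of_notMem_tsupport _ _ _ _ hz

/-- **The re-localisation identity**: only neighbours contribute,
`(errOne)~_j(s, z) = Σ_{i ∈ N j} ρ_j(Ψ_j z) • err̃_i(s, Ψ_i⁻¹ Ψ_j z)`. [cite: Hormander1985III, §17.1] -/
theorem dataAd_errOne_eq (j : ι) (s : ℝ) (z : E') :
    dataAd Q A (errOne Q A T S 𝔟 𝔠 Θ) j s z =
      ∑ i ∈ nbrs Q j, Q.ρ j (psi Q A j z) • errAd Q A T S 𝔟 𝔠 Θ i s (psiInv Q A i (psi Q A j z)) := by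
  classical
  simp only [dataAd, errOne, errPiece, Finset.smul_sum]
  refine (Finset.sum_subset (Finset.subset_univ _) fun i _ hi ↦ ?_).symm
  by_cases hρ : Q.ρ j (psi Q A j z) = 0
  · rw [hρ, zero_smul]
  · have h := errPiece_eq_zero_of_not_mem_nbrs Q A T S 𝔟 𝔠 Θ hi s hρ
    simp only [errPiece] at h
    rw [h, smul_zero]

/-! ### Slab smoothness of the adapted residuals -/

omit [MeasurableSpace E'] [BorelSpace E'] [FiniteDimensional ℝ F'] in
/-- The adapted coefficient slices are slab-smooth. [folklore] -/
theorem isSmoothSpaceTimeOn_Sad (hS : IsSmoothSpaceTimeOn (Icc 0 T) S) (i : ι) :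
    IsSmoothSpaceTimeOn (Icc 0 T) (Sad Q A S i) := by
  have h := hS.comp_space (contDiff_psi (Q := Q) (A := A) i)
  unfold IsSmoothSpaceTimeOn at h ⊢
  have : uncurry (Sad Q A S i) = fun q : ℝ × E' ↦ (A i : E' →L[ℝ] E') ∘L (uncurry fun s z ↦ S s (psi Q A i z)) q ∘L
      ContinuousLinearMap.adjoint (A i : E' →L[ℝ] E') := by
    funext ⟨s, z⟩; rfl
  rw [this]
  exact (contDiffOn_const.clm_comp h).clm_comp contDiffOn_const

omit [FiniteDimensional ℝ E'] [MeasurableSpace E'] [BorelSpace E'] [FiniteDimensional ℝ F'] in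
/-- The adapted first-order coefficient slices are slab-smooth. [folklore] -/
theorem isSmoothSpaceTimeOn_Bad (h𝔟 : IsSmoothSpaceTimeOn (Icc 0 T) 𝔟) (i : ι) :
    IsSmoothSpaceTimeOn (Icc 0 T) (Bad Q A 𝔟 i) := by
  have h := h𝔟.comp_space (contDiff_psi (Q := Q) (A := A) i)
  unfold IsSmoothSpaceTimeOn at h ⊢
  have : uncurry (Bad Q A 𝔟 i) = fun q : ℝ × E' ↦ (uncurry fun s z ↦ 𝔟 s (psi Q A i z)) q ∘L
      precompCLM (A i : E' →L[ℝ] E') := by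
    funext ⟨s, z⟩; rfl
  rw [this]
  exact h.clm_comp contDiffOn_const

omit [FiniteDimensional ℝ E'] [MeasurableSpace E'] [BorelSpace E'] [FiniteDimensional ℝ F'] in
/-- The adapted zeroth-order coefficient slices are slab-smooth. [folklore] -/
theorem isSmoothSpaceTimeOn_Cad (h𝔠 : IsSmoothSpaceTimeOn (Icc 0 T) 𝔠) (i : ι) :
    IsSmoothSpaceTimeOn (Icc 0 T) (Cad Q A 𝔠 i) :=
  h𝔠.comp_space (contDiff_psi (Q := Q) (A := A) i)

/-- The local heat solutions are slab-smooth. [folklore] -/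
theorem isSmoothSpaceTimeOn_wAd (hT : 0 < T) (hΘ : IsSmoothSpaceTimeOn (Icc 0 T) Θ) (i : ι) :
    IsSmoothSpaceTimeOn (Icc 0 T) (wAd Q A T Θ i) :=
  isSmoothSpaceTimeOn_flatLocalSol hT (isSmoothSpaceTimeOn_dataAd hΘ i) (isCompact_supportAd i) (dataAd_eq_zero i)

/-- **The adapted residuals are slab-smooth.** [folklore] -/
theorem isSmoothSpaceTimeOn_errAd (hT : 0 < T) (hΘ : IsSmoothSpaceTimeOn (Icc 0 T) Θ)
    (hS : IsSmoothSpaceTimeOn (Icc 0 T) S) (h𝔟 : IsSmoothSpaceTimeOn (Icc 0 T) 𝔟) (h𝔠 : IsSmoothSpaceTimeOn (Icc 0 T) 𝔠)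
    (i : ι) : IsSmoothSpaceTimeOn (Icc 0 T) (errAd Q A T S 𝔟 𝔠 Θ i) :=
  isSmoothSpaceTimeOn_flatErr hT (isSmoothSpaceTimeOn_Sad Q A T S hS i) (isSmoothSpaceTimeOn_Bad Q A T 𝔟 h𝔟 i)
    (isSmoothSpaceTimeOn_Cad Q A T 𝔠 h𝔠 i) (contDiff_cutAd i) (isSmoothSpaceTimeOn_wAd Q A T Θ hT hΘ i)

/-! ### The contraction estimate -/

/-- **One step contracts the data norm.** See the module docstring. [cite: Hormander1985III, §17.1] -/
theorem lintegral_weight_sum_dataAd_errOne_le (hT : 0 < T) (hΘ : IsSmoothSpaceTimeOn (Icc 0 T) Θ)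
    (hS : IsSmoothSpaceTimeOn (Icc 0 T) S) (h𝔟 : IsSmoothSpaceTimeOn (Icc 0 T) 𝔟) (h𝔠 : IsSmoothSpaceTimeOn (Icc 0 T) 𝔠)
    (k : ℕ) {Csh A₀ B₀ Ctr : ℝ≥0∞} {Mρ : ℝ}
    -- the sharp product rule at order `k` with constant `Csh` (`Csh = 0` for `k = 0`)
    (hsharp : ∀ {m : E' → ℝ} {g : E' → F'}, ContDiff ℝ ∞ m → ContDiff ℝ ∞ g → ∀ {M₀ M : ℝ}, (∀ x, |m x| ≤ M₀) →
      (∀ l : List (Fin (Module.finrank ℝ E')), l ≠ [] → l.length ≤ k →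
        ∀ x, ‖iterDirDeriv (l.map (stdOrthonormalBasis ℝ E')) m x‖ ≤ M) →
      sobolevEnergy k (fun x ↦ m x • g x) ≤
        2 * ENNReal.ofReal (M₀ ^ 2) * sobolevEnergy k g + Csh * ENNReal.ofReal (M ^ 2) * sobolevEnergy (k - 1) g)
    (hCsh0 : k = 0 → Csh = 0)
    -- the per-patch slice bounds at orders `k` and `k - 1`
    (hslice : ∀ i, ∀ s ∈ Icc 0 T, sobolevEnergy k (errAd Q A T S 𝔟 𝔠 Θ i s) ≤
      A₀ * ∑ a, ∑ l, sobolevEnergy k (fun y ↦ fderiv ℝ (fun z ↦ fderiv ℝ (wAd Q A T Θ i s) z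
        (stdOrthonormalBasis ℝ E' l)) y (stdOrthonormalBasis ℝ E' a)) +
      B₀ * (∑ l, sobolevEnergy k (fun z ↦ fderiv ℝ (wAd Q A T Θ i s) z (stdOrthonormalBasis ℝ E' l)) +
        sobolevEnergy k (wAd Q A T Θ i s)))
    (hslice' : ∀ i, ∀ s ∈ Icc 0 T, sobolevEnergy (k - 1) (errAd Q A T S 𝔟 𝔠 Θ i s) ≤
      A₀ * ∑ a, ∑ l, sobolevEnergy (k - 1) (fun y ↦ fderiv ℝ (fun z ↦ fderiv ℝ (wAd Q A T Θ i s) z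
        (stdOrthonormalBasis ℝ E' l)) y (stdOrthonormalBasis ℝ E' a)) +
      B₀ * (∑ l, sobolevEnergy (k - 1) (fun z ↦ fderiv ℝ (wAd Q A T Θ i s) z (stdOrthonormalBasis ℝ E' l)) +
        sobolevEnergy (k - 1) (wAd Q A T Θ i s)))
    -- the partition multipliers in adapted coordinates
    (hρw : ∀ j, ∀ lst : List (Fin (Module.finrank ℝ E')), lst ≠ [] → lst.length ≤ k →
      ∀ z, ‖iterDirDeriv (lst.map (stdOrthonormalBasis ℝ E')) (fun z ↦ Q.ρ j (psi Q A j z)) z‖ ≤ Mρ)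
    -- the transport constants between neighbours, at orders `k` and `k - 1`
    (htr : ∀ j, ∀ i ∈ nbrs Q j, ∀ k' ≤ k, ENNReal.ofReal (max 1 (‖((A i : E' →L[ℝ] E') ∘L ((A j).symm : E' →L[ℝ] E'))‖ ^ 2) ^ k' *
      |(LinearMap.det (((A i : E' →L[ℝ] E') ∘L ((A j).symm : E' →L[ℝ] E') : E' →L[ℝ] E') : E' →ₗ[ℝ] E'))⁻¹|) ≤ Ctr)
    {lam : ℝ} (hlam : 0 < lam) {t : ℝ} (ht : t ∈ Icc 0 T) :
    ∑ j, ∫⁻ s in Ioo 0 t, ENNReal.ofReal (Real.exp (-2 * lam * s)) *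
        sobolevEnergy k (dataAd Q A (errOne Q A T S 𝔟 𝔠 Θ) j s) ≤
      ENNReal.ofReal ((2 * (5 * Q.r) / Q.mesh + 1) ^ Module.finrank ℝ E') ^ 2 * Ctr *
        (2 * (A₀ * (Module.finrank ℝ E' : ℝ≥0∞) + B₀ * (ENNReal.ofReal (lam⁻¹ / 2) + ENNReal.ofReal (lam⁻¹ ^ 2))) +
          Csh * ENNReal.ofReal (Mρ ^ 2) * (A₀ * (Module.finrank ℝ E' : ℝ≥0∞) * ENNReal.ofReal (lam⁻¹ / 2) +
            B₀ * (ENNReal.ofReal (lam⁻¹ / 2) + ENNReal.ofReal (lam⁻¹ ^ 2)))) *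
        ∑ i, ∫⁻ s in Ioo 0 t, ENNReal.ofReal (Real.exp (-2 * lam * s)) * sobolevEnergy k (dataAd Q A Θ i s) := by
  classical
  -- notation
  set W : ℝ → ℝ≥0∞ := fun s ↦ ENNReal.ofReal (Real.exp (-2 * lam * s)) with hW
  have hWm : AEMeasurable W (volume.restrict (Ioo 0 t)) :=
    (Real.continuous_exp.comp (continuous_const.mul continuous_id)).measurable.ennreal_ofReal.aemeasurable
  set mm : ℝ≥0∞ := ENNReal.ofReal ((2 * (5 * Q.r) / Q.mesh + 1) ^ Module.finrank ℝ E') with hmm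
  set K₁ : ℝ≥0∞ := A₀ * (Module.finrank ℝ E' : ℝ≥0∞) + B₀ * (ENNReal.ofReal (lam⁻¹ / 2) + ENNReal.ofReal (lam⁻¹ ^ 2)) with hK₁
  set K₂ : ℝ≥0∞ := A₀ * (Module.finrank ℝ E' : ℝ≥0∞) * ENNReal.ofReal (lam⁻¹ / 2) +
    B₀ * (ENNReal.ofReal (lam⁻¹ / 2) + ENNReal.ofReal (lam⁻¹ ^ 2)) with hK₂
  set R : ι → ℝ≥0∞ := fun i ↦ ∫⁻ s in Ioo 0 t, W s * sobolevEnergy k (dataAd Q A Θ i s) with hR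
  set err := errAd Q A T S 𝔟 𝔠 Θ with herr
  set M : ι → ι → E' →L[ℝ] E' := fun i j ↦ (A i : E' →L[ℝ] E') ∘L ((A j).symm : E' →L[ℝ] E') with hM
  set v : ι → ι → E' := fun i j ↦ A i (Q.c j - Q.c i) with hv
  -- multiplicities
  have hcard : ∀ j, ((nbrs Q j).card : ℝ≥0∞) ≤ mm := by
    intro j
    rw [hmm, ← ENNReal.ofReal_natCast]
    exact ENNReal.ofReal_le_ofReal (card_nbrs_le Q j)
  -- smoothness facts
  have hws : ∀ i, IsSmoothSpaceTimeOn (Icc 0 T) (wAd Q A T Θ i) := fun i ↦ isSmoothSpaceTimeOn_wAd Q A T Θ hT hΘ i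
  have herrs : ∀ i, IsSmoothSpaceTimeOn (Icc 0 T) (err i) := fun i ↦
    isSmoothSpaceTimeOn_errAd Q A T S 𝔟 𝔠 Θ hT hΘ hS h𝔟 h𝔠 i
  have herrsl : ∀ i, ∀ s ∈ Icc 0 T, ContDiff ℝ ∞ (err i s) := fun i s hs ↦ (herrs i).contDiff_slice hs
  have hρs : ∀ j, ContDiff ℝ ∞ fun z ↦ Q.ρ j (psi Q A j z) := fun j ↦ (Q.ρ_smooth j).comp (contDiff_psi j)
  have hρ1 : ∀ j z, |Q.ρ j (psi Q A j z)| ≤ 1 := fun j z ↦ by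
    rw [abs_of_nonneg (Q.ρ_nonneg j _)]; exact Q.ρ_le_one j _
  -- the per-patch weighted bounds (engine)
  have hE1 : ∀ i, ∫⁻ s in Ioo 0 t, W s * sobolevEnergy k (err i s) ≤ K₁ * R i := fun i ↦
    lintegral_weight_sobolevEnergy_flatErr_le hT (isSmoothSpaceTimeOn_dataAd hΘ i) (isCompact_supportAd i)
      (dataAd_eq_zero i) k (hslice i) hlam ht
  have hE2 : ∀ i, Csh * (∫⁻ s in Ioo 0 t, W s * sobolevEnergy (k - 1) (err i s)) ≤ Csh * (K₂ * R i) := by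
    intro i
    rcases Nat.eq_zero_or_pos k with hk | hk
    · rw [hCsh0 hk, zero_mul, zero_mul]
    · refine mul_le_mul' le_rfl ?_
      obtain ⟨j', rfl⟩ : ∃ j', k = j' + 1 := ⟨k - 1, by omega⟩
      have hsl : ∀ s ∈ Icc 0 T, sobolevEnergy j' (errAd Q A T S 𝔟 𝔠 Θ i s) ≤
          A₀ * ∑ a, ∑ l, sobolevEnergy j' (fun y ↦ fderiv ℝ (fun z ↦ fderiv ℝ (wAd Q A T Θ i s) z
            (stdOrthonormalBasis ℝ E' l)) y (stdOrthonormalBasis ℝ E' a)) +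
          B₀ * (∑ l, sobolevEnergy j' (fun z ↦ fderiv ℝ (wAd Q A T Θ i s) z (stdOrthonormalBasis ℝ E' l)) +
            sobolevEnergy j' (wAd Q A T Θ i s)) := by
        intro s hs
        have h := hslice' i s hs
        rwa [Nat.add_sub_cancel] at h
      have h := lintegral_weight_sobolevEnergy_flatErr_le_succ hT (isSmoothSpaceTimeOn_dataAd hΘ i) (isCompact_supportAd i)
        (dataAd_eq_zero i) j' hsl hlam ht
      rw [Nat.add_sub_cancel]
      exact h
  -- Step 1: per patch `j`, the energy of the re-localised residual at time `s`
  have hstep1 : ∀ j, ∀ s ∈ Icc 0 T, sobolevEnergy k (dataAd Q A (errOne Q A T S 𝔟 𝔠 Θ) j s) ≤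
      mm * ∑ i ∈ nbrs Q j, (2 * Ctr * sobolevEnergy k (err i s) + Csh * ENNReal.ofReal (Mρ ^ 2) * Ctr *
        sobolevEnergy (k - 1) (err i s)) := by
    intro j s hs
    have heq : dataAd Q A (errOne Q A T S 𝔟 𝔠 Θ) j s = fun z ↦ ∑ i ∈ nbrs Q j, Q.ρ j (psi Q A j z) •
        err i s (M i j z + v i j) := by
      funext z
      rw [dataAd_errOne_eq]
      refine Finset.sum_congr rfl fun i _ ↦ ?_
      rw [psiInv_psi_eq]
    rw [heq]
    have hsm : ∀ i ∈ nbrs Q j, ContDiff ℝ k fun z ↦ Q.ρ j (psi Q A j z) • err i s (M i j z + v i j) := fun i _ ↦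
      ((hρs j).smul ((herrsl i s hs).comp ((M i j).contDiff.add contDiff_const))).of_le (by exact_mod_cast le_top)
    refine (sobolevEnergy_sum_le_card k (nbrs Q j) hsm).trans ?_
    refine (mul_le_mul' (hcard j) le_rfl).trans (mul_le_mul' le_rfl (Finset.sum_le_sum fun i hi ↦ ?_))
    -- sharp product rule with the partition function, then transport
    have hcomp : ContDiff ℝ ∞ fun z ↦ err i s (M i j z + v i j) := (herrsl i s hs).comp ((M i j).contDiff.add contDiff_const)
    refine (hsharp (hρs j) hcomp (hρ1 j) (hρw j)).trans ?_
    rw [one_pow, ENNReal.ofReal_one, mul_one]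
    have htk : sobolevEnergy k (fun z ↦ err i s (M i j z + v i j)) ≤ Ctr * sobolevEnergy k (err i s) :=
      (sobolevEnergy_comp_affine_le (M i j) (det_transition_ne_zero A i j) (v i j) k (herrsl i s hs)).trans
        (mul_le_mul' (htr j i hi k le_rfl) le_rfl)
    have htk' : sobolevEnergy (k - 1) (fun z ↦ err i s (M i j z + v i j)) ≤ Ctr * sobolevEnergy (k - 1) (err i s) :=
      (sobolevEnergy_comp_affine_le (M i j) (det_transition_ne_zero A i j) (v i j) (k - 1) (herrsl i s hs)).trans
        (mul_le_mul' (htr j i hi (k - 1) (Nat.sub_le k 1)) le_rfl)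
    calc 2 * sobolevEnergy k (fun z ↦ err i s (M i j z + v i j)) +
          Csh * ENNReal.ofReal (Mρ ^ 2) * sobolevEnergy (k - 1) (fun z ↦ err i s (M i j z + v i j))
        ≤ 2 * (Ctr * sobolevEnergy k (err i s)) + Csh * ENNReal.ofReal (Mρ ^ 2) * (Ctr * sobolevEnergy (k - 1) (err i s)) :=
          add_le_add (mul_le_mul' le_rfl htk) (mul_le_mul' le_rfl htk')
      _ = _ := by ring
  -- Step 2: integrate in time
  have mE : ∀ i, AEMeasurable (fun s ↦ sobolevEnergy k (err i s)) (volume.restrict (Ioo 0 t)) := fun i ↦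
    aemeasurable_sobolevEnergy_slice_Ioo' (herrs i) k ht.2
  have mE' : ∀ i, AEMeasurable (fun s ↦ sobolevEnergy (k - 1) (err i s)) (volume.restrict (Ioo 0 t)) := fun i ↦
    aemeasurable_sobolevEnergy_slice_Ioo' (herrs i) (k - 1) ht.2
  have mWE : ∀ i, AEMeasurable (fun s ↦ W s * sobolevEnergy k (err i s)) (volume.restrict (Ioo 0 t)) := fun i ↦
    hWm.mul (mE i)
  have mWE' : ∀ i, AEMeasurable (fun s ↦ W s * sobolevEnergy (k - 1) (err i s)) (volume.restrict (Ioo 0 t)) := fun i ↦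
    hWm.mul (mE' i)
  have hstep2 : ∀ j, ∫⁻ s in Ioo 0 t, W s * sobolevEnergy k (dataAd Q A (errOne Q A T S 𝔟 𝔠 Θ) j s) ≤
      mm * ∑ i ∈ nbrs Q j, (2 * Ctr * (∫⁻ s in Ioo 0 t, W s * sobolevEnergy k (err i s)) +
        Csh * ENNReal.ofReal (Mρ ^ 2) * Ctr * ∫⁻ s in Ioo 0 t, W s * sobolevEnergy (k - 1) (err i s)) := by
    intro j
    calc ∫⁻ s in Ioo 0 t, W s * sobolevEnergy k (dataAd Q A (errOne Q A T S 𝔟 𝔠 Θ) j s)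
        ≤ ∫⁻ s in Ioo 0 t, W s * (mm * ∑ i ∈ nbrs Q j, (2 * Ctr * sobolevEnergy k (err i s) +
            Csh * ENNReal.ofReal (Mρ ^ 2) * Ctr * sobolevEnergy (k - 1) (err i s))) :=
          setLIntegral_mono' measurableSet_Ioo fun s hs ↦ mul_le_mul' le_rfl (hstep1 j s ⟨hs.1.le, hs.2.le.trans ht.2⟩)
      _ = mm * ∑ i ∈ nbrs Q j, (2 * Ctr * (∫⁻ s in Ioo 0 t, W s * sobolevEnergy k (err i s)) +
            Csh * ENNReal.ofReal (Mρ ^ 2) * Ctr * ∫⁻ s in Ioo 0 t, W s * sobolevEnergy (k - 1) (err i s)) := by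
          have m1 : ∀ i, AEMeasurable (fun s ↦ 2 * Ctr * (W s * sobolevEnergy k (err i s)))
              (volume.restrict (Ioo 0 t)) := fun i ↦ (mWE i).const_mul _
          have m2 : ∀ i, AEMeasurable (fun s ↦ Csh * ENNReal.ofReal (Mρ ^ 2) * Ctr * (W s * sobolevEnergy (k - 1) (err i s)))
              (volume.restrict (Ioo 0 t)) := fun i ↦ (mWE' i).const_mul _
          have m12 : ∀ i, AEMeasurable (fun s ↦ 2 * Ctr * (W s * sobolevEnergy k (err i s)) +
              Csh * ENNReal.ofReal (Mρ ^ 2) * Ctr * (W s * sobolevEnergy (k - 1) (err i s))) (volume.restrict (Ioo 0 t)) :=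
            fun i ↦ (m1 i).add (m2 i)
          have msum : AEMeasurable (fun s ↦ ∑ i ∈ nbrs Q j, (2 * Ctr * (W s * sobolevEnergy k (err i s)) +
              Csh * ENNReal.ofReal (Mρ ^ 2) * Ctr * (W s * sobolevEnergy (k - 1) (err i s)))) (volume.restrict (Ioo 0 t)) :=
            Finset.aemeasurable_fun_sum _ fun i _ ↦ m12 i
          calc _ = ∫⁻ s in Ioo 0 t, mm * ∑ i ∈ nbrs Q j, (2 * Ctr * (W s * sobolevEnergy k (err i s)) +
                Csh * ENNReal.ofReal (Mρ ^ 2) * Ctr * (W s * sobolevEnergy (k - 1) (err i s))) := by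
                refine lintegral_congr fun s ↦ ?_
                rw [← mul_assoc, mul_comm (W s) mm, mul_assoc, Finset.mul_sum]
                congr 1
                exact Finset.sum_congr rfl fun i _ ↦ by ring
            _ = mm * ∑ i ∈ nbrs Q j, ∫⁻ s in Ioo 0 t, (2 * Ctr * (W s * sobolevEnergy k (err i s)) +
                Csh * ENNReal.ofReal (Mρ ^ 2) * Ctr * (W s * sobolevEnergy (k - 1) (err i s))) := by
                rw [lintegral_const_mul'' mm msum, lintegral_finsetSum' _ fun i _ ↦ m12 i]
            _ = _ := by
                congr 1
                refine Finset.sum_congr rfl fun i _ ↦ ?_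
                rw [lintegral_add_left' (m1 i), lintegral_const_mul'' _ (mWE i), lintegral_const_mul'' _ (mWE' i)]
  -- Step 3: the engine per neighbour and double counting
  have hstep3 : ∀ j, ∫⁻ s in Ioo 0 t, W s * sobolevEnergy k (dataAd Q A (errOne Q A T S 𝔟 𝔠 Θ) j s) ≤
      mm * ∑ i ∈ nbrs Q j, Ctr * (2 * K₁ + Csh * ENNReal.ofReal (Mρ ^ 2) * K₂) * R i := by
    intro j
    refine (hstep2 j).trans (mul_le_mul' le_rfl (Finset.sum_le_sum fun i _ ↦ ?_))
    calc 2 * Ctr * (∫⁻ s in Ioo 0 t, W s * sobolevEnergy k (err i s)) +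
          Csh * ENNReal.ofReal (Mρ ^ 2) * Ctr * ∫⁻ s in Ioo 0 t, W s * sobolevEnergy (k - 1) (err i s)
        = 2 * Ctr * (∫⁻ s in Ioo 0 t, W s * sobolevEnergy k (err i s)) +
          ENNReal.ofReal (Mρ ^ 2) * Ctr * (Csh * ∫⁻ s in Ioo 0 t, W s * sobolevEnergy (k - 1) (err i s)) := by ring
      _ ≤ 2 * Ctr * (K₁ * R i) + ENNReal.ofReal (Mρ ^ 2) * Ctr * (Csh * (K₂ * R i)) :=
          add_le_add (mul_le_mul' le_rfl (hE1 i)) (mul_le_mul' le_rfl (hE2 i))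
      _ = Ctr * (2 * K₁ + Csh * ENNReal.ofReal (Mρ ^ 2) * K₂) * R i := by ring
  -- double counting over the symmetric neighbour relation
  have hdc : ∑ j, ∑ i ∈ nbrs Q j, R i ≤ mm * ∑ i, R i := by
    have h1 : ∑ j, ∑ i ∈ nbrs Q j, R i = ∑ i, ∑ j ∈ nbrs Q i, R i := by
      rw [Finset.sum_comm' (t' := Finset.univ) (s' := fun i ↦ nbrs Q i)]
      intro j i
      simp only [Finset.mem_univ, true_and, and_true]
      exact mem_nbrs_comm Q
    rw [h1, Finset.mul_sum]
    refine Finset.sum_le_sum fun i _ ↦ ?_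
    rw [Finset.sum_const, nsmul_eq_mul]
    exact mul_le_mul' (hcard i) le_rfl
  calc ∑ j, ∫⁻ s in Ioo 0 t, W s * sobolevEnergy k (dataAd Q A (errOne Q A T S 𝔟 𝔠 Θ) j s)
      ≤ ∑ j, mm * ∑ i ∈ nbrs Q j, Ctr * (2 * K₁ + Csh * ENNReal.ofReal (Mρ ^ 2) * K₂) * R i :=
        Finset.sum_le_sum fun j _ ↦ hstep3 j
    _ = mm * (Ctr * (2 * K₁ + Csh * ENNReal.ofReal (Mρ ^ 2) * K₂)) * ∑ j, ∑ i ∈ nbrs Q j, R i := by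
        rw [Finset.mul_sum]
        refine Finset.sum_congr rfl fun j _ ↦ ?_
        rw [Finset.mul_sum, Finset.mul_sum]
        exact Finset.sum_congr rfl fun i _ ↦ by ring
    _ ≤ mm * (Ctr * (2 * K₁ + Csh * ENNReal.ofReal (Mρ ^ 2) * K₂)) * (mm * ∑ i, R i) := mul_le_mul' le_rfl hdc
    _ = mm ^ 2 * Ctr * (2 * K₁ + Csh * ENNReal.ofReal (Mρ ^ 2) * K₂) * ∑ i, R i := by ring

end FlatStep

end Literature.Analysis.PDE

end
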